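import Literature.NumberTheory.Transcendental.MultipleZetaStuffle

/-!
# SoloInformed — LIII F7: the series side of the hook identities is Kaneko–Yamamoto's
`k ⊛ ((1,…,1))^★`

Solo programme `solo-KontsevichZagierPeriods-informed`, session s54 (PROGRAMME LIII, file F7).

THEOREM LIII (files `HookBase`, `Hook`) proves in Kontsevich's formal period ring `𝒫` the
identities `HOOK(u, i+1)`: the sum of `Z` over the linear extensions of the hook 2-poset of an
admissible index `u` with `i + 1` bullets equals `Σ_{w ∈ HookWords u 0 (i+1)} Z(w)`, where
`soloInformedHookWords` (defined HERE, §2) is the word evolution produced by the stuffle-type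
placement process of file `HookStates`.  This file identifies that right-hand side with the
SERIES side of Kaneko–Yamamoto's integral–series identity [Kaneko–Yamamoto 2018 = arXiv:1605.03117,
Thm 4.1: `ζ(μ(k,l)) = ζ(k ⊛ l^★)`] for `l = (1,…,1)`:

* `soloInformedStar l` (§3) is K–Y's `l^★` — the `2^{s−1}` indices obtained from `l` by merging
  blocks of adjacent entries; `soloInformedComp n = (1^n)^★` = the compositions of `n`;
* K–Y's circled harmonic product `v e_k ⊛ w e_l = (v ∗ w) e_{k+l}` glues the LAST entries and
  stuffles the fronts.  K–Y write `ζ(k_1,…,k_r) = Σ_{m_1<⋯<m_r}` (admissible iff `k_r ≥ 2`); the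
  Literature's `multipleZeta u` uses the reversed convention (`2 ≤ u.head`), so in our orientation
  `k ⊛ c` is `(u_1 − 1 + c_1) :: (u.tail ∗ c.tail)` for `u = (k_r + 1, k_{r−1}, …, k_1)`, with
  `∗ = MZV.stuffle` (Hoffman's rules (A1)–(A3), Literature `MultipleZetaStuffle`).

MAIN THEOREM (`soloInformed_hookWords_series`, §5): for every prefix `P`, letter `a`, tail `T`,
  `Σ_{w ∈ HookWords (P ++ a :: T) |P| n} F w
     = Σ_{j ≤ n} Σ_{c ∈ Comp(n − j)} Σ_{v ∈ T ∗ c} F (P ++ (a + j) :: v)`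
(the letter at the starting position absorbs `j` of the ones, the remaining ones enter the tail as
the blocks of a composition, quasi-shuffled), and its literal K–Y form (`_KY`, §6):
  `Σ_{w ∈ HookWords (a :: T) 0 n} F w = Σ_{d ∈ (1^{n+1})^★} Σ_{v ∈ T ∗ d.tail} F ((a − 1 + d_1) :: v)`,
i.e. the right-hand side of `HOOK(u, n)` is `Z(k ⊛ ((1^{n+1}))^★)` with `k = (u_{k+1},…,u_2,u_1−1)`.
Since the hook poset of `u` with `n` bullets IS K–Y's `μ(k, (1^{n+1}))` (two chains below the top
`∘`), THEOREM LIII is exactly K–Y's identity (4.1) for all pairs `(k, (1,…,1))` — the family which,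
with the finite double shuffle relations (THEOREMS XLII, XLVII), yields the regularisation theorem
of Ihara–Kaneko–Zagier by the algebra of [K–Y §5] (Lemma 5.2 `(A_ш)`, `(A_∗)` and the non-star
twin of Prop. 5.4).  Ingredients: Hoffman's rule (A3) iterated — in `T ∗ (d :: D)` the letter `d`
lands after the first `s` letters of `T` or merges with the `s`-th (§4) — and the first-part split
of compositions (§3).  Pure list combinatorics; no analysis.

References: Kaneko–Yamamoto, Selecta Math. 24 (2018) [arXiv:1605.03117] §2, Thm 4.1, §5;
Hoffman 1997 §2; Ihara–Kaneko–Zagier 2006 Thm 1. -/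

open Finset

namespace Summit.KontsevichZagierPeriods.KontsevichZagierPeriods.Theorems

open Literature.NumberTheory.Transcendental

/-! ## 1. List lemmas -/

section lists

variable {M : Type*} [AddCommMonoid M]

/-- `map` through `flatMap`. -/
theorem soloInformed_map_flatMap {α γ δ : Type*} (l : List α) (F : α → List γ)
    (g : γ → δ) :
    (l.flatMap F).map g = l.flatMap fun a => (F a).map g := by
  induction l with
  | nil => rfl
  | cons a l ih => rw [List.flatMap_cons, List.flatMap_cons, List.map_append, ih]

/-- Congruence for `flatMap` along the members of the list. -/
theorem soloInformed_flatMap_congr {α γ : Type*} {l : List α} {F G : α → List γ}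
    (h : ∀ a ∈ l, F a = G a) : l.flatMap F = l.flatMap G := by
  induction l with
  | nil => rfl
  | cons a l ih =>
    rw [List.flatMap_cons, List.flatMap_cons, h a (by simp),
      ih fun x hx => h x (List.mem_cons_of_mem a hx)]

/-- The sum of a `flatMap`, mapped into an additive monoid. -/
theorem soloInformed_sum_map_flatMap {α γ : Type*} (l : List α) (F : α → List γ)
    (g : γ → M) : ((l.flatMap F).map g).sum = (l.map fun a => ((F a).map g).sum).sum := by
  induction l with
  | nil => rfl
  | cons a l ih =>
    rw [List.flatMap_cons, List.map_append, List.sum_append, ih, List.map_cons,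
      List.sum_cons]

/-- A `Finset.range` sum as a `List.range` sum. -/
theorem soloInformed_sum_range_eq_list (f : ℕ → M) :
    ∀ n : ℕ, ∑ s ∈ Finset.range n, f s = ((List.range n).map f).sum
  | 0 => by simp
  | n + 1 => by
    rw [Finset.sum_range_succ, List.range_succ, List.map_append, List.sum_append,
      soloInformed_sum_range_eq_list f n, List.map_singleton, List.sum_singleton]

/-- The sum of a `flatMap` over `List.range` as a `Finset.range` sum. -/
theorem soloInformed_sum_flatMap_range {γ : Type*} (k : ℕ) (f : ℕ → List γ) (F : γ → M) :
    (((List.range k).flatMap f).map F).sum = ∑ s ∈ Finset.range k, ((f s).map F).sum := by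
  rw [soloInformed_sum_map_flatMap, soloInformed_sum_range_eq_list]

/-- A finite sum inside a list sum may be pulled out. -/
theorem soloInformed_list_sum_finset_comm {β σ : Type*} (l : List β) (S : Finset σ)
    (g : β → σ → M) :
    (l.map fun c => ∑ s ∈ S, g c s).sum = ∑ s ∈ S, (l.map fun c => g c s).sum := by
  induction l with
  | nil => simp
  | cons b l ih => simp only [List.map_cons, List.sum_cons, ih, Finset.sum_add_distrib]

/-- `take` past a prefix. -/
theorem soloInformed_take_length_add (P Q : List ℕ) (s : ℕ) :
    (P ++ Q).take (P.length + s) = P ++ Q.take s := by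
  induction P with
  | nil => simp
  | cons p P ih =>
    rw [List.length_cons, show P.length + 1 + s = (P.length + s) + 1 by omega, List.cons_append,
      List.take_succ_cons, ih, List.cons_append]

/-- `drop` past a prefix. -/
theorem soloInformed_drop_length_add (P Q : List ℕ) (s : ℕ) :
    (P ++ Q).drop (P.length + s) = Q.drop s := by
  induction P with
  | nil => simp
  | cons p P ih =>
    rw [List.length_cons, show P.length + 1 + s = (P.length + s) + 1 by omega, List.cons_append,
      List.drop_succ_cons, ih]

end lists

/-! ## 2. The word evolution of the placement process (the series side of `HOOK`) -/

section words

/-- **The word evolution.** Starting from a word `wd` (the index `(fib_0,…,fib_K)`) and a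
position `pos`, place `i` letters: each is a new letter `1` inserted after position `pos + s`
(continue from position `pos + s + 1`) or raises the entry at position `pos + s` by one
(continue from position `pos + s`), `0 ≤ s < |wd| − pos`. -/
def soloInformedHookWords : List ℕ → ℕ → ℕ → List (List ℕ)
  | wd, _, 0 => [wd]
  | wd, pos, i + 1 =>
      (List.range (wd.length - pos)).flatMap fun s =>
        soloInformedHookWords (wd.take (pos + s + 1) ++ 1 :: wd.drop (pos + s + 1))
            (pos + s + 1) i ++
          soloInformedHookWords (wd.take (pos + s) ++ (wd.getD (pos + s) 0 + 1) ::
            wd.drop (pos + s + 1)) (pos + s) i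

/-- No letter to place: the word itself. -/
@[simp] theorem soloInformedHookWords_zero (wd : List ℕ) (pos : ℕ) :
    soloInformedHookWords wd pos 0 = [wd] := rfl

/-- One more letter: insert `1` after / raise the entry at position `pos + s`. -/
theorem soloInformedHookWords_succ (wd : List ℕ) (pos i : ℕ) :
    soloInformedHookWords wd pos (i + 1) =
      (List.range (wd.length - pos)).flatMap fun s =>
        soloInformedHookWords (wd.take (pos + s + 1) ++ 1 :: wd.drop (pos + s + 1))
            (pos + s + 1) i ++
          soloInformedHookWords (wd.take (pos + s) ++ (wd.getD (pos + s) 0 + 1) ::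
            wd.drop (pos + s + 1)) (pos + s) i := rfl

end words

/-! ## 3. Kaneko–Yamamoto's `l^★` and the compositions `(1^n)^★` -/

section star

variable {M : Type*} [AddCommMonoid M]

/-- `(a :: l)^★`: merge blocks of adjacent entries (K–Y §2: each comma becomes `,` or `+`). -/
def soloInformedStarAux : ℕ → List ℕ → List (List ℕ)
  | a, [] => [[a]]
  | a, b :: l => (soloInformedStarAux b l).map (List.cons a) ++ soloInformedStarAux (a + b) l

/-- Kaneko–Yamamoto's `l^★` as a list of indices (with `∅^★ = ∅`, one empty index).
[Kaneko–Yamamoto 2018, §2] -/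
def soloInformedStar : List ℕ → List (List ℕ)
  | [] => [[]]
  | a :: l => soloInformedStarAux a l

/-- `(a)^★ = (a)`. -/
@[simp] theorem soloInformedStarAux_nil (a : ℕ) : soloInformedStarAux a [] = [[a]] := rfl

/-- `(a, b, l)^★ = a :: (b, l)^★ + (a + b, l)^★`. -/
theorem soloInformedStarAux_cons (a b : ℕ) (l : List ℕ) :
    soloInformedStarAux a (b :: l) =
      (soloInformedStarAux b l).map (List.cons a) ++ soloInformedStarAux (a + b) l := rfl

/-- The compositions of `n`, as `(1,…,1)^★`. -/
def soloInformedComp (n : ℕ) : List (List ℕ) := soloInformedStar (List.replicate n 1)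

/-- The empty composition of `0`. -/
@[simp] theorem soloInformedComp_zero : soloInformedComp 0 = [[]] := rfl

/-- Compositions of `n + 1`. -/
theorem soloInformedComp_succ (n : ℕ) :
    soloInformedComp (n + 1) = soloInformedStarAux 1 (List.replicate n 1) := rfl

/-- Sanity: the compositions of `3`. -/
example : soloInformedComp 3 = [[1, 1, 1], [1, 2], [2, 1], [3]] := by decide

/-- **First-part split.** `Σ_{d ∈ (b,1^n)^★} G d = Σ_{j ≤ n} Σ_{c ∈ Comp(n − j)} G ((b + j) :: c)`:
an element of `(b, 1, …, 1)^★` is `b` merged with the first `j` ones, followed by a composition of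
the remaining `n − j`. -/
theorem soloInformed_sum_starAux_replicate (G : List ℕ → M) : ∀ (n b : ℕ),
    ((soloInformedStarAux b (List.replicate n 1)).map G).sum =
      ∑ j ∈ range (n + 1), ((soloInformedComp (n - j)).map fun c => G ((b + j) :: c)).sum
  | 0, b => by simp
  | n + 1, b => by
    rw [List.replicate_succ, soloInformedStarAux_cons, List.map_append, List.sum_append,
      List.map_map, soloInformed_sum_starAux_replicate G n (b + 1),
      Finset.sum_range_succ' _ (n + 1)]
    refine (add_comm _ _).trans (congrArg₂ (· + ·) (Finset.sum_congr rfl fun j _ => ?_) ?_)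
    · simp only [Nat.add_sub_add_right, add_assoc, add_comm 1 j]
    · simp [soloInformedComp_succ, Function.comp_def]

end star

/-! ## 4. Hoffman's rule (A3) iterated: where the first letter of the second factor lands -/

section stuffle

variable {M : Type*} [AddCommMonoid M]

/-- In `T ∗ (d :: D)` the letter `d` is either inserted after the first `s` letters of `T`
(`0 ≤ s ≤ |T|`), the rest being `T.drop s ∗ D`, or merged with the `s`-th letter of `T`
(`0 ≤ s < |T|`), the rest being `T.drop (s+1) ∗ D`; the first `s` letters of `T` stay in front.
[Hoffman 1997 §2 (A3), iterated] -/
theorem soloInformed_sum_stuffle_cons (d : ℕ) (D : List ℕ) :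
    ∀ (T : List ℕ) (F : List ℕ → M),
    ((MZV.stuffle T (d :: D)).map F).sum =
      ∑ s ∈ range (T.length + 1),
          ((MZV.stuffle (T.drop s) D).map fun v => F (T.take s ++ d :: v)).sum +
        ∑ s ∈ range T.length,
          ((MZV.stuffle (T.drop (s + 1)) D).map fun v => F (T.take s ++ (T.getD s 0 + d) :: v)).sum
  | [], F => by simp
  | t :: T, F => by
    rw [MZV.stuffle_cons_cons, List.map_append, List.map_append, List.sum_append,
      List.sum_append, List.map_map, List.map_map, List.map_map,
      soloInformed_sum_stuffle_cons d D T (F ∘ List.cons t), List.length_cons]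
    conv_rhs => rw [Finset.sum_range_succ' _ T.length, Finset.sum_range_succ' _ (T.length + 1)]
    simp only [Function.comp_apply, List.drop_succ_cons, List.take_succ_cons, List.drop_zero,
      List.take_zero, List.nil_append, List.cons_append, List.getD_cons_succ,
      List.getD_cons_zero, Function.comp_def, zero_add]
    abel

end stuffle

/-! ## 5. The main theorem: `HookWords` = "absorb `j` ones, quasi-shuffle a composition of the
rest into the tail" -/

section main

variable {M : Type*} [AddCommMonoid M]

/-- The insertion word at offset `s ≤ |T|`, as prefix ++ `1` :: rest. -/
theorem soloInformed_hook_insWord (P : List ℕ) (a : ℕ) (T : List ℕ) {s : ℕ}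
    (hs : s ≤ T.length) :
    (P ++ a :: T).take (P.length + s + 1) ++ 1 :: (P ++ a :: T).drop (P.length + s + 1) =
      (P ++ a :: T.take s) ++ 1 :: T.drop s ∧ P.length + s + 1 = (P ++ a :: T.take s).length := by
  refine ⟨?_, ?_⟩
  · rw [show P.length + s + 1 = P.length + (s + 1) by omega, soloInformed_take_length_add,
      soloInformed_drop_length_add, List.take_succ_cons, List.drop_succ_cons, List.append_assoc,
      List.cons_append]
  · simp only [List.length_append, List.length_cons, List.length_take, Nat.min_eq_left hs]
    omega

/-- The raising word at offset `0`. -/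
theorem soloInformed_hook_raiseWord_zero (P : List ℕ) (a : ℕ) (T : List ℕ) :
    (P ++ a :: T).take (P.length + 0) ++ ((P ++ a :: T).getD (P.length + 0) 0 + 1) ::
        (P ++ a :: T).drop (P.length + 0 + 1) = P ++ (a + 1) :: T := by
  rw [soloInformed_take_length_add, List.getD_append_right _ _ _ _ (Nat.le_add_right _ _), Nat.add_sub_cancel_left,
    show P.length + 0 + 1 = P.length + 1 by rfl, soloInformed_drop_length_add]
  simp

/-- The raising word at offset `s + 1 ≤ |T|`, as prefix ++ raised letter :: rest. -/
theorem soloInformed_hook_raiseWord_succ (P : List ℕ) (a : ℕ) (T : List ℕ) {s : ℕ}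
    (hs : s < T.length) :
    (P ++ a :: T).take (P.length + (s + 1)) ++ ((P ++ a :: T).getD (P.length + (s + 1)) 0 + 1) ::
        (P ++ a :: T).drop (P.length + (s + 1) + 1) =
      (P ++ a :: T.take s) ++ (T.getD s 0 + 1) :: T.drop (s + 1) ∧
      P.length + (s + 1) = (P ++ a :: T.take s).length := by
  refine ⟨?_, ?_⟩
  · rw [soloInformed_take_length_add, List.getD_append_right _ _ _ _ (Nat.le_add_right _ _), Nat.add_sub_cancel_left,
      show P.length + (s + 1) + 1 = P.length + (s + 2) by omega, soloInformed_drop_length_add,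
      List.take_succ_cons, List.getD_cons_succ, show s + 2 = (s + 1) + 1 by rfl,
      List.drop_succ_cons, List.append_assoc, List.cons_append]
  · simp only [List.length_append, List.length_cons, List.length_take, Nat.min_eq_left hs.le]

/-- **LIII F7, main theorem.** The word evolution started at position `|P|` of `P ++ a :: T`
with `n` letters enumerates, with multiplicity, the words `P ++ (a + j) :: v` with `0 ≤ j ≤ n`,
`c` a composition of `n − j` and `v ∈ T ∗ c` (Hoffman's stuffle): as an identity of sums over
any additive commutative monoid. -/
theorem soloInformed_hookWords_series : ∀ (n : ℕ) (P : List ℕ) (a : ℕ) (T : List ℕ)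
    (F : List ℕ → M),
    ((soloInformedHookWords (P ++ a :: T) P.length n).map F).sum =
      ∑ j ∈ range (n + 1), ((soloInformedComp (n - j)).map fun c =>
        ((MZV.stuffle T c).map fun v => F (P ++ (a + j) :: v)).sum).sum
  | 0, P, a, T, F => by simp
  | n + 1, P, a, T, F => by
    have IH := soloInformed_hookWords_series n
    rw [soloInformedHookWords_succ, soloInformed_sum_flatMap_range,
      show (P ++ a :: T).length - P.length = T.length + 1 by simp]
    -- split each summand into its insertion and its raising part
    have hsplit : ∀ s ∈ range (T.length + 1),
        ((soloInformedHookWords ((P ++ a :: T).take (P.length + s + 1) ++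
              1 :: (P ++ a :: T).drop (P.length + s + 1)) (P.length + s + 1) n ++
            soloInformedHookWords ((P ++ a :: T).take (P.length + s) ++
              ((P ++ a :: T).getD (P.length + s) 0 + 1) :: (P ++ a :: T).drop (P.length + s + 1))
              (P.length + s) n).map F).sum =
          (∑ j ∈ range (n + 1), ((soloInformedComp (n - j)).map fun c =>
              ((MZV.stuffle (T.drop s) c).map fun v =>
                F (P ++ a :: (T.take s ++ (1 + j) :: v))).sum).sum) +
          ((soloInformedHookWords ((P ++ a :: T).take (P.length + s) ++
              ((P ++ a :: T).getD (P.length + s) 0 + 1) :: (P ++ a :: T).drop (P.length + s + 1))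
              (P.length + s) n).map F).sum := by
      intro s hs
      rw [Finset.mem_range] at hs
      obtain ⟨e1, e2⟩ := soloInformed_hook_insWord P a T (s := s) (by omega)
      rw [List.map_append, List.sum_append]
      congr 1
      rw [e1, e2, IH]
      simp only [List.append_assoc, List.cons_append]
    rw [Finset.sum_congr rfl hsplit, Finset.sum_add_distrib]
    -- the raising parts
    have hr0 : ((soloInformedHookWords ((P ++ a :: T).take (P.length + 0) ++
        ((P ++ a :: T).getD (P.length + 0) 0 + 1) :: (P ++ a :: T).drop (P.length + 0 + 1))
        (P.length + 0) n).map F).sum =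
        ∑ j ∈ range (n + 1), ((soloInformedComp (n - j)).map fun c =>
          ((MZV.stuffle T c).map fun v => F (P ++ (a + (j + 1)) :: v)).sum).sum := by
      rw [soloInformed_hook_raiseWord_zero, show P.length + 0 = P.length from rfl, IH]
      refine Finset.sum_congr rfl fun j _ => ?_
      simp only [add_assoc, add_comm 1 j]
    have hrs : ∀ s ∈ range T.length, ((soloInformedHookWords
        ((P ++ a :: T).take (P.length + (s + 1)) ++
          ((P ++ a :: T).getD (P.length + (s + 1)) 0 + 1) ::
            (P ++ a :: T).drop (P.length + (s + 1) + 1)) (P.length + (s + 1)) n).map F).sum =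
        ∑ j ∈ range (n + 1), ((soloInformedComp (n - j)).map fun c =>
          ((MZV.stuffle (T.drop (s + 1)) c).map fun v =>
            F (P ++ a :: (T.take s ++ (T.getD s 0 + (1 + j)) :: v))).sum).sum := by
      intro s hs
      rw [Finset.mem_range] at hs
      obtain ⟨e1, e2⟩ := soloInformed_hook_raiseWord_succ P a T hs
      rw [e1, e2, IH]
      simp only [List.append_assoc, List.cons_append, add_assoc]
    conv_lhs => arg 2; rw [Finset.sum_range_succ']
    rw [hr0, Finset.sum_congr rfl hrs]
    -- the right-hand side: split off `j = 0` and expand the compositions of `n + 1`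
    rw [Finset.sum_range_succ' (fun j => ((soloInformedComp (n + 1 - j)).map fun c =>
        ((MZV.stuffle T c).map fun v => F (P ++ (a + j) :: v)).sum).sum)]
    simp only [Nat.add_sub_add_right, Nat.sub_zero, add_zero, soloInformedComp_succ]
    rw [soloInformed_sum_starAux_replicate]
    simp only [soloInformed_sum_stuffle_cons _ _ T, List.sum_map_add,
      soloInformed_list_sum_finset_comm, Finset.sum_add_distrib]
    rw [Finset.sum_comm (s := range (T.length + 1)) (t := range (n + 1)),
      Finset.sum_comm (s := range T.length) (t := range (n + 1))]
    abel

/-- **LIII F7 at the head** (`P = []`): `Σ_{w ∈ HookWords (a :: T) 0 n} F w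
  = Σ_{j ≤ n} Σ_{c ∈ Comp(n−j)} Σ_{v ∈ T ∗ c} F ((a + j) :: v)`. -/
theorem soloInformed_hookWords_series_head (a : ℕ) (T : List ℕ) (n : ℕ) (F : List ℕ → M) :
    ((soloInformedHookWords (a :: T) 0 n).map F).sum =
      ∑ j ∈ range (n + 1), ((soloInformedComp (n - j)).map fun c =>
        ((MZV.stuffle T c).map fun v => F ((a + j) :: v)).sum).sum := by
  have h := soloInformed_hookWords_series (M := M) n [] a T F
  simpa using h

end main

/-! ## 6. The literal Kaneko–Yamamoto form: `k ⊛ ((1^{n+1}))^★` -/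

section KY

variable {M : Type*} [AddCommMonoid M]

/-- **The series side of `HOOK(u, n)` is `Z(k ⊛ ((1,…,1)_{n+1})^★)`** (our orientation):
for `u = a :: T` with `a ≥ 1`,
  `Σ_{w ∈ HookWords u 0 n} F w = Σ_{d ∈ (1^{n+1})^★} Σ_{v ∈ T ∗ d.tail} F ((a − 1 + d_1) :: v)`,
the `d`-sum running over the compositions of `n + 1` — the index `k = (…, u_2, u_1 − 1)` of K–Y
glued with the last block of `d` and its front quasi-shuffled with the other blocks.
[Kaneko–Yamamoto 2018, §2 (`ve_k ⊛ we_l = (v∗w)e_{k+l}`), Thm 4.1 with `l = (1^{n+1})`] -/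
theorem soloInformed_hookWords_series_KY {a : ℕ} (ha : 1 ≤ a) (T : List ℕ) (n : ℕ)
    (F : List ℕ → M) :
    ((soloInformedHookWords (a :: T) 0 n).map F).sum =
      ((soloInformedComp (n + 1)).map fun d =>
        ((MZV.stuffle T d.tail).map fun v => F ((a - 1 + d.headI) :: v)).sum).sum := by
  rw [soloInformed_hookWords_series_head, soloInformedComp_succ,
    soloInformed_sum_starAux_replicate]
  refine Finset.sum_congr rfl fun j _ => ?_
  simp only [List.tail_cons, List.headI_cons, show a - 1 + (1 + j) = a + j by omega]

/-- Sanity (`HOOK((2),2)`): `HookWords (2) 0 2 = (2,1,1),(2,2),(3,1),(4)` and the K–Y side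
`(1) ⊛ ((1,1,1))^★` lists the same words. -/
example : soloInformedHookWords [2] 0 2 = [[2, 1, 1], [2, 2], [3, 1], [4]] := by decide

end KY

end Summit.KontsevichZagierPeriods.KontsevichZagierPeriods.Theorems
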